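import Literature.Probability.LatticeModels.ImprovedTreeDiagramBoundAssembly
import Literature.Probability.LatticeModels.IntersectionClusteringSkeleton
import Literature.Probability.LatticeModels.AnnulusCrossing
import HarnessLib

/-!
# The intersection-clustering bound from the intersection and mixing properties (Aizenman–Duminil-Copin 2021, proof of Prop. 4.3 / Prop. 6.1): the probabilistic assembly on a finite graph

Topic `Literature/Probability/LatticeModels`; family `crit-ising`. Theorems and auxiliary definitions
only: **no named fact is introduced** (D-0026); the two probabilistic inputs of the printed proof enter
as hypotheses spelled out in the statements.

M. Aizenman, H. Duminil-Copin, *Marginal triviality of the scaling limits of critical 4D Ising and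
`φ⁴₄` models*, Ann. of Math. **194** (2021) = arXiv:1912.07973 [AizenmanDuminilCopinAnnals2021] prove
the intersection-clustering bound (**Proposition 6.1**, p. 21; conditional version **Proposition 4.3**,
p. 10: "`P^{ux,uz,uy,ut}_β[𝐌_u(𝒯; 𝓛, K) < δK] ≤ 2^{-δK}`") on pp. 14–15 ("exactly identical" on p. 22)
from two probabilistic inputs,

* the **intersection property** (Lemma 4.4 / **Lemma 6.2**: "`P^{0y,0y,∅,∅}_β[I_k] ≥ c`"), and
* the **mixing property** (Prop. 4.6 / **Theorem 6.4**: "`|P[E ∩ F] - P[E]P[F]| ≤ s (log N/n)^{-c}`"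
  for `E` depending on the currents inside `Λ_n`, `F` on the currents outside `Λ_N`, together with
  its second part (6.9), the insensitivity of `P[E]` to the placement of the far sources),

by four moves which the tree already has in proved form: the counting/union bound and the removal of
two of the four sources (`IntersectionClusteringSkeleton`: `Current.clusteringMass_le_sum_fourAvoidMass`,
`Current.clusteringMass_mul_sq_le_sum`), the inclusion `B_S ⊆ A_S` (`AnnulusCrossing`:
`Current.annulusOccupied_of_ikEvent`), the induction `P[A_S] ≤ (1-c₀)^{|S|}`
(`le_pow_card_of_erase_max_step`) and the numerics (`exists_delta_choose_mul_pow_le_exp_neg`).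

This file performs the **assembly of these moves with the two probabilistic inputs**, on an arbitrary
finite simple graph whose vertex type carries a pseudo-metric (the setting of `ClusteringToTreeBound`),
for couplings `K ≥ 0`, in un-normalised current-sum form. The inputs are hypotheses of the theorems,
stated for the four-current measure `P^{uy,∅} ⊗ P^{uy,∅}` (`= P^{uy,uy,∅,∅}` up to the ordering of the
currents) exactly in the form in which the printed proof consumes them:

* `Current.fourMass K u a b Φ = ∑ 1{∂n₁=∅}1{∂n₃={a,u}} w w · 1{∂n₂=∅}1{∂n₄={b,u}} w w · Φ` — the
  un-normalised expectation of `Φ` under `P^{ua,ub,∅,∅}` (source layout of the tree's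
  `Current.fourAvoidMass K ∅ ({a} ∆ {u}) ∅ ({b} ∆ {u})`), with normalisation `Current.fourNrm`;
  `Current.FourLocal A Φ` — `Φ` depends on the four currents only through their values on the edge set
  `A`; `Current.edgesWithin u r` / `Current.edgesBeyond u r` — the edges inside the closed ball /
  outside the open ball of radius `r` about `u` (the printed "edges within `Λ_n`" / "outside of `Λ_N`",
  centred at `u`);
* `Current.ikInd ℓ u k`, `Current.asInd ℓ u S` — the indicators of the printed events `I_k` (the tree's
  `Current.IkEvent` on the annulus `u + Ann(ℓ_k, ℓ_{k+1})`) and `A_S = ⋂_{k ∈ S} I_kᶜ`; their locality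
  (`fourLocal_ikInd_within/beyond`, `fourLocal_asInd`), and **`B_S ⊆ A_S`** in mass form
  (`fourAvoidMass_le_fourMass_asInd`);
* `Current.fourMass_asInd_le_pow` — **the induction** ("the mixing property used with `n = ℓ_{s-1}` and
  `N = ℓ_s` gives `P[A_S] ≤ P[I_sᶜ] P[A_{S∖{s}}] + (error)` … the intersection property … gives
  `P[A_S] ≤ (1-2c₀)P[A_{S∖{s}}] + c₀(1-c₀)^{|S|-1}`. An induction gives `P[A_S] ≤ (1-c₀)^{|S|}`"): from the
  intersection property at every usable index `s ∈ E` (`2c₀ · Nrm ≤ fourMass (ikInd s)`) and the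
  one-sided mixing inequality between functionals local inside `Λ_{ℓ_{s-1}}(u)` and functionals local
  outside `Λ_{ℓ_s}(u)` with an error `ε_s ≤ c₀(1-c₀)^{#{k ∈ E : k < s}}`, for a set `E` of indices with
  gaps `≥ 2` (the printed "even integers"), conclude `fourMass (asInd S) ≤ (1-c₀)^{|S|} · Nrm` for all
  `S ⊆ E`;
* `Current.clusteringMassLT_le_of_inputs` — **Prop. 6.1 in finite volume, modulo the inputs**: adding the
  union bound over `S` (general threshold `θ`, `Current.clusteringMassLT` of
  `ImprovedTreeDiagramBoundAssembly`), the removal of the sources `y', t'`, `B_S ⊆ A_S`, and the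
  relocation of the two remaining far sources `x, z` to a common far vertex `y` (the printed
  "`P^{0x,0z,∅,∅}[A_S] ≤ P^{0y,0y,∅,∅}[A_S] + C/√(log ℓ_{K-1})`", hypothesis `hrel`):
  `clusteringMassLT(θ)(x,y',z,t';u) ≤ binom(|E|, |E|+1-θ) ((1-c₀)^{|E|+1-θ} + ε_rel) · Z[xu]Z[y'u]Z[zu]Z[t'u]`.

The lattice specialisation (dynamic scales `ℓ_k(β,D)`, regular far vertex `y` from Thm 5.12, `D`
large through Lemma 6.3, the numerics and the passage to `aizenmanDuminilCopin_improvedTreeDiagramBound`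
through `improvedTreeDiagramBound_of_boxClustering`) is the business of the companion file
`IntersectionClusteringBound`.

## References

* M. Aizenman, H. Duminil-Copin, Ann. of Math. 194 (2021), arXiv:1912.07973: §4.2, proof of Prop. 4.3
  (pp. 14–15); §6.1, Prop. 6.1, Lemma 6.2 and the proof of Prop. 6.1 (pp. 21–22); Thm 6.4 (p. 21–22)
  [AizenmanDuminilCopinAnnals2021].

## Mathlib

`ENNReal.tsum_le_tsum`, `ENNReal.tsum_add`, `ENNReal.tsum_mul_left/right`, `ENNReal.toReal` algebra,
`Finset.max'`, `Finset.powersetCard`, `Finset.card_powersetCard`. No random currents in Mathlib.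
-/

noncomputable section

open Finset Filter
open scoped symmDiff ENNReal

namespace Literature.Probability.LatticeModels

variable {V : Type*} [Fintype V] [DecidableEq V] {G : SimpleGraph V} [DecidableRel G.Adj]

namespace Current

/-! ### Part 1. Four currents: the measure `P^{ua,∅} ⊗ P^{ub,∅}`, functionals, locality -/

variable (G) in
/-- A configuration of the four currents `((n₁,n₃),(n₂,n₄))` of Aizenman–Duminil-Copin 2021, §4.1
(two independent double currents; the clusters in play are those of `n₁+n₃` and `n₂+n₄`).
[cite: AizenmanDuminilCopinAnnals2021, arXiv:1912.07973 §3.2–§4.1, the measure P^{xy,zt,∅,∅}] -/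
abbrev FourCfg : Type _ := (Current G × Current G) × (Current G × Current G)

/-- The un-normalised weight of the four currents `P^{ua,ub,∅,∅}` in the source layout of the tree's
`Current.fourAvoidMass K ∅ ({a} ∆ {u}) ∅ ({b} ∆ {u})`: the second current of each pair carries the
sources, `W(p,q) = 1{∂p₁=∅}1{∂p₂={a,u}} w w · 1{∂q₁=∅}1{∂q₂={b,u}} w w`.
[cite: AizenmanDuminilCopinAnnals2021, arXiv:1912.07973 §4.2, the measure P^{0x,0z,∅,∅} (p. 14)] -/
def fourWeight (K : G.edgeFinset → ℝ) (u a b : V) (pq : FourCfg G) : ℝ≥0∞ :=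
  epairWeight K ∅ ({a} ∆ {u}) pq.1 * epairWeight K ∅ ({b} ∆ {u}) pq.2

/-- The un-normalised expectation `∑ W(p,q) Φ(p,q)` of a functional `Φ ≥ 0` of the four currents under
`P^{ua,ub,∅,∅}` (the probability of an event `E` is `fourMass 𝟙_E / fourNrm`).
[cite: AizenmanDuminilCopinAnnals2021, arXiv:1912.07973 §4.2, the measure P^{0x,0z,∅,∅} (p. 14)] -/
def fourMass (K : G.edgeFinset → ℝ) (u a b : V) (Φ : FourCfg G → ℝ≥0∞) : ℝ≥0∞ :=
  ∑' pq, fourWeight K u a b pq * Φ pq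

/-- The normalisation `Z[∅]Z[{a,u}] · Z[∅]Z[{b,u}]` of `P^{ua,ub,∅,∅}`. [folklore] -/
def fourNrm (K : G.edgeFinset → ℝ) (u a b : V) : ℝ≥0∞ :=
  ecurrentSum K ∅ * ecurrentSum K ({a} ∆ {u}) * (ecurrentSum K ∅ * ecurrentSum K ({b} ∆ {u}))

variable {K : G.edgeFinset → ℝ}

/-- The total weight is the normalisation: `fourMass 1 = fourNrm`. [folklore] -/
theorem fourMass_one (K : G.edgeFinset → ℝ) (u a b : V) :
    fourMass K u a b (fun _ => 1) = fourNrm K u a b := by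
  unfold fourMass fourNrm fourWeight
  simp_rw [mul_one]
  rw [← tsum_mul_tsum_eq_tsum_prod (fun p => epairWeight K ∅ ({a} ∆ {u}) p)
    (fun q => epairWeight K ∅ ({b} ∆ {u}) q), tsum_epairWeight, tsum_epairWeight]

/-- Monotonicity of `fourMass` in the functional. [folklore] -/
theorem fourMass_mono (K : G.edgeFinset → ℝ) (u a b : V) {Φ Ψ : FourCfg G → ℝ≥0∞} (h : ∀ pq, Φ pq ≤ Ψ pq) :
    fourMass K u a b Φ ≤ fourMass K u a b Ψ :=
  ENNReal.tsum_le_tsum fun pq => mul_le_mul' le_rfl (h pq)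

/-- Monotonicity on the support: it suffices to compare `Φ ≤ Ψ` where the weight is non-zero. [folklore] -/
theorem fourMass_mono_of_support (K : G.edgeFinset → ℝ) (u a b : V) {Φ Ψ : FourCfg G → ℝ≥0∞}
    (h : ∀ pq, fourWeight K u a b pq ≠ 0 → Φ pq ≤ Ψ pq) :
    fourMass K u a b Φ ≤ fourMass K u a b Ψ := by
  refine ENNReal.tsum_le_tsum fun pq => ?_
  by_cases hw : fourWeight K u a b pq = 0
  · simp [hw]
  · exact mul_le_mul' le_rfl (h pq hw)

/-- Additivity of `fourMass`. [folklore] -/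
theorem fourMass_add (K : G.edgeFinset → ℝ) (u a b : V) (Φ Ψ : FourCfg G → ℝ≥0∞) :
    fourMass K u a b (Φ + Ψ) = fourMass K u a b Φ + fourMass K u a b Ψ := by
  unfold fourMass
  rw [← ENNReal.tsum_add]
  refine tsum_congr fun pq => ?_
  rw [Pi.add_apply, mul_add]

/-- Homogeneity of `fourMass`. [folklore] -/
theorem fourMass_const_mul (K : G.edgeFinset → ℝ) (u a b : V) (c : ℝ≥0∞) (Φ : FourCfg G → ℝ≥0∞) :
    fourMass K u a b (fun pq => c * Φ pq) = c * fourMass K u a b Φ := by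
  unfold fourMass
  rw [← ENNReal.tsum_mul_left]
  refine tsum_congr fun pq => ?_
  ring

/-- A functional bounded by `1` has mass at most the normalisation. [folklore] -/
theorem fourMass_le_fourNrm (K : G.edgeFinset → ℝ) (u a b : V) {Φ : FourCfg G → ℝ≥0∞} (h : ∀ pq, Φ pq ≤ 1) :
    fourMass K u a b Φ ≤ fourNrm K u a b := by
  rw [← fourMass_one K u a b]
  exact fourMass_mono K u a b h

/-- The normalisation is finite for `K ≥ 0`. [folklore] -/
theorem fourNrm_ne_top (hK : ∀ e, 0 ≤ K e) (u a b : V) : fourNrm K u a b ≠ ∞ :=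
  ENNReal.mul_ne_top (ENNReal.mul_ne_top (ecurrentSum_ne_top hK _) (ecurrentSum_ne_top hK _))
    (ENNReal.mul_ne_top (ecurrentSum_ne_top hK _) (ecurrentSum_ne_top hK _))

/-- A functional bounded by `1` has finite mass (`K ≥ 0`). [folklore] -/
theorem fourMass_ne_top (hK : ∀ e, 0 ≤ K e) (u a b : V) {Φ : FourCfg G → ℝ≥0∞} (h : ∀ pq, Φ pq ≤ 1) :
    fourMass K u a b Φ ≠ ∞ :=
  ne_top_of_le_ne_top (fourNrm_ne_top hK u a b) (fourMass_le_fourNrm K u a b h)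

/-- The tree's avoidance mass in the four-current language:
`fourAvoidMass K ∅ ({a} ∆ {u}) ∅ ({b} ∆ {u}) u T = fourMass K u a b (fourAvoidInd u T)`. [folklore] -/
theorem fourAvoidMass_eq_fourMass (K : G.edgeFinset → ℝ) (u a b : V) (T : Finset V) :
    fourAvoidMass K ∅ ({a} ∆ {u}) ∅ ({b} ∆ {u}) u T = fourMass K u a b (fourAvoidInd u T) := rfl

/-- On the support of the weight the sources are as prescribed: `∂p₁ = ∅`, `∂p₂ = {a,u}`, `∂q₁ = ∅`,
`∂q₂ = {b,u}`. [folklore] -/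
theorem sources_of_fourWeight_ne_zero {u a b : V} {pq : FourCfg G} (h : fourWeight K u a b pq ≠ 0) :
    pq.1.1.sources = ∅ ∧ pq.1.2.sources = {a} ∆ {u} ∧ pq.2.1.sources = ∅ ∧ pq.2.2.sources = {b} ∆ {u} := by
  unfold fourWeight epairWeight at h
  by_cases h1 : pq.1.1.sources = ∅ ∧ pq.1.2.sources = {a} ∆ {u}
  · by_cases h2 : pq.2.1.sources = ∅ ∧ pq.2.2.sources = {b} ∆ {u}
    · exact ⟨h1.1, h1.2, h2.1, h2.2⟩
    · rw [if_neg h2, mul_zero] at h; exact absurd rfl h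
  · rw [if_neg h1, zero_mul] at h; exact absurd rfl h

/-- On the support of the weight, `a ∈ C_{n₁+n₃}(u)` and `b ∈ C_{n₂+n₄}(u)` (the sources of a current
are connected). [folklore] -/
theorem mem_cluster_of_fourWeight_ne_zero {u a b : V} {pq : FourCfg G} (h : fourWeight K u a b pq ≠ 0) :
    a ∈ (pq.1.1 + pq.1.2).cluster u ∧ b ∈ (pq.2.1 + pq.2.2).cluster u := by
  obtain ⟨-, h12, -, h22⟩ := sources_of_fourWeight_ne_zero h
  constructor
  · have hu : u ∈ pq.1.2.cluster a := mem_cluster_of_sources_eq h12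
    exact cluster_mono (le_add_self : pq.1.2 ≤ pq.1.1 + pq.1.2) u (mem_cluster_comm.1 hu)
  · have hu : u ∈ pq.2.2.cluster b := mem_cluster_of_sources_eq h22
    exact cluster_mono (le_add_self : pq.2.2 ≤ pq.2.1 + pq.2.2) u (mem_cluster_comm.1 hu)

/-- Two four-current configurations **agree on an edge set** `A`. [folklore] -/
def FourAgree (A : Finset G.edgeFinset) (pq pq' : FourCfg G) : Prop :=
  ∀ e ∈ A, pq.1.1 e = pq'.1.1 e ∧ pq.1.2 e = pq'.1.2 e ∧ pq.2.1 e = pq'.2.1 e ∧ pq.2.2 e = pq'.2.2 e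

/-- **Locality of a functional of the four currents** on an edge set `A` ("events depending on the
restriction of `(n₁,…,n_s)` to edges within `Λ_n` [resp. outside of `Λ_N`]", Aizenman–Duminil-Copin 2021,
Thm 6.4): `Φ` takes equal values on configurations agreeing on `A`.
[cite: AizenmanDuminilCopinAnnals2021, arXiv:1912.07973 Thm 6.4 (p. 21–22)] -/
def FourLocal (A : Finset G.edgeFinset) (Φ : FourCfg G → ℝ≥0∞) : Prop :=
  ∀ pq pq' : FourCfg G, FourAgree A pq pq' → Φ pq = Φ pq'

omit [DecidableEq V] in
/-- Locality is monotone in the edge set. [folklore] -/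
theorem FourLocal.mono {A B : Finset G.edgeFinset} (hAB : A ⊆ B) {Φ : FourCfg G → ℝ≥0∞}
    (h : FourLocal A Φ) : FourLocal B Φ :=
  fun pq pq' hag => h pq pq' fun e he => hag e (hAB he)

omit [DecidableEq V] in
/-- Products of local functionals are local. [folklore] -/
theorem FourLocal.mul {A : Finset G.edgeFinset} {Φ Ψ : FourCfg G → ℝ≥0∞} (hΦ : FourLocal A Φ)
    (hΨ : FourLocal A Ψ) : FourLocal A (Φ * Ψ) :=
  fun pq pq' hag => by rw [Pi.mul_apply, Pi.mul_apply, hΦ pq pq' hag, hΨ pq pq' hag]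

omit [DecidableEq V] in
/-- Constants are local. [folklore] -/
theorem fourLocal_const (A : Finset G.edgeFinset) (c : ℝ≥0∞) : FourLocal A (fun _ : FourCfg G => c) :=
  fun _ _ _ => rfl

section Metric

variable [PseudoMetricSpace V]

/-- **The edges within `Λ_r(u)`**: all endpoints at distance `≤ r` from `u`.
[cite: AizenmanDuminilCopinAnnals2021, arXiv:1912.07973 Thm 6.4 ("edges within Λ_n")] -/
def edgesWithin (u : V) (r : ℕ) : Finset G.edgeFinset :=
  univ.filter fun e => ∀ v ∈ (e : Sym2 V), dist u v ≤ r

/-- **The edges outside `Λ_r(u)`**: all endpoints at distance `≥ r` from `u`.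
[cite: AizenmanDuminilCopinAnnals2021, arXiv:1912.07973 Thm 6.4 ("edges … outside of Λ_N")] -/
def edgesBeyond (u : V) (r : ℕ) : Finset G.edgeFinset :=
  univ.filter fun e => ∀ v ∈ (e : Sym2 V), (r : ℝ) ≤ dist u v

/-- Membership in `edgesWithin`. [folklore] -/
theorem mem_edgesWithin {u : V} {r : ℕ} {e : G.edgeFinset} :
    e ∈ edgesWithin u r ↔ ∀ v ∈ (e : Sym2 V), dist u v ≤ r := by
  unfold edgesWithin; simp

/-- Membership in `edgesBeyond`. [folklore] -/
theorem mem_edgesBeyond {u : V} {r : ℕ} {e : G.edgeFinset} :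
    e ∈ edgesBeyond u r ↔ ∀ v ∈ (e : Sym2 V), (r : ℝ) ≤ dist u v := by
  unfold edgesBeyond; simp

/-- `edgesWithin` is monotone in the radius. [folklore] -/
theorem edgesWithin_mono (u : V) {r r' : ℕ} (h : r ≤ r') : edgesWithin (G := G) u r ⊆ edgesWithin u r' := by
  intro e he
  rw [mem_edgesWithin] at he ⊢
  exact fun v hv => (he v hv).trans (by exact_mod_cast h)

/-! ### Part 2. The events `I_k`, `A_S`: indicators, locality, and `B_S ⊆ A_S` -/

open Classical in
/-- The indicator of the event `I_k` of Aizenman–Duminil-Copin 2021 for the four currents: unique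
crossing clusters of `u + Ann(ℓ_k, ℓ_{k+1})` in `n₁+n₃` and in `n₂+n₄`, which intersect (the tree's
`Current.IkEvent`). [cite: AizenmanDuminilCopinAnnals2021, arXiv:1912.07973 §4.2, definition of I_k (p. 11); §6.1 (p. 21)] -/
def ikInd (ℓ : ℕ → ℕ) (u : V) (k : ℕ) (pq : FourCfg G) : ℝ≥0∞ :=
  if IkEvent (annulusFinset ℓ u k) (ℓ k) (ℓ (k + 1)) u (pq.1.1 + pq.1.2) (pq.2.1 + pq.2.2) then 1 else 0

open Classical in
/-- The indicator of the complement `I_kᶜ`. [cite: AizenmanDuminilCopinAnnals2021, arXiv:1912.07973 §4.2, proof of Prop. 4.3 (the factor P[I_sᶜ], p. 14)] -/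
def ikcInd (ℓ : ℕ → ℕ) (u : V) (k : ℕ) (pq : FourCfg G) : ℝ≥0∞ :=
  if IkEvent (annulusFinset ℓ u k) (ℓ k) (ℓ (k + 1)) u (pq.1.1 + pq.1.2) (pq.2.1 + pq.2.2) then 0 else 1

open Classical in
/-- The indicator of the event `A_S` "that no `I_k` occurs for `k ∈ S`".
[cite: AizenmanDuminilCopinAnnals2021, arXiv:1912.07973 §4.2, proof of Prop. 4.3 (event A_S, p. 14)] -/
def asInd (ℓ : ℕ → ℕ) (u : V) (S : Finset ℕ) (pq : FourCfg G) : ℝ≥0∞ :=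
  if ∀ k ∈ S, ¬ IkEvent (annulusFinset ℓ u k) (ℓ k) (ℓ (k + 1)) u (pq.1.1 + pq.1.2) (pq.2.1 + pq.2.2)
    then 1 else 0

/-- `𝟙[I_k] ≤ 1`. [folklore] -/
theorem ikInd_le_one (ℓ : ℕ → ℕ) (u : V) (k : ℕ) (pq : FourCfg G) : ikInd ℓ u k pq ≤ 1 := by
  unfold ikInd
  split_ifs
  · exact le_rfl
  · exact zero_le_one

/-- `𝟙[I_kᶜ] ≤ 1`. [folklore] -/
theorem ikcInd_le_one (ℓ : ℕ → ℕ) (u : V) (k : ℕ) (pq : FourCfg G) : ikcInd ℓ u k pq ≤ 1 := by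
  unfold ikcInd
  split_ifs
  · exact zero_le_one
  · exact le_rfl

/-- `𝟙[A_S] ≤ 1`. [folklore] -/
theorem asInd_le_one (ℓ : ℕ → ℕ) (u : V) (S : Finset ℕ) (pq : FourCfg G) : asInd ℓ u S pq ≤ 1 := by
  unfold asInd
  split_ifs
  · exact le_rfl
  · exact zero_le_one

/-- `𝟙[I_k] + 𝟙[I_kᶜ] = 1`. [folklore] -/
theorem ikInd_add_ikcInd (ℓ : ℕ → ℕ) (u : V) (k : ℕ) (pq : FourCfg G) :
    ikInd ℓ u k pq + ikcInd ℓ u k pq = 1 := by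
  unfold ikInd ikcInd
  split_ifs
  · exact add_zero 1
  · exact zero_add 1

/-- `A_∅` is the sure event. [folklore] -/
theorem asInd_empty (ℓ : ℕ → ℕ) (u : V) (pq : FourCfg G) : asInd ℓ u ∅ pq = 1 := by
  unfold asInd
  rw [if_pos]
  exact fun k hk => absurd hk (Finset.notMem_empty k)

/-- `𝟙[A_S] = 𝟙[A_{S∖{s}}] · 𝟙[I_sᶜ]` for `s ∈ S`. [cite: AizenmanDuminilCopinAnnals2021, arXiv:1912.07973 §4.2, proof of Prop. 4.3 (A_S ⊆ A_{S∖{s}} ∩ I_sᶜ, p. 14)] -/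
theorem asInd_eq_erase_mul {ℓ : ℕ → ℕ} {u : V} {S : Finset ℕ} {s : ℕ} (hs : s ∈ S) (pq : FourCfg G) :
    asInd ℓ u S pq = asInd ℓ u (S.erase s) pq * ikcInd ℓ u s pq := by
  unfold asInd ikcInd
  by_cases hI : IkEvent (annulusFinset ℓ u s) (ℓ s) (ℓ (s + 1)) u (pq.1.1 + pq.1.2) (pq.2.1 + pq.2.2)
  · rw [if_pos hI, mul_zero, if_neg]
    exact fun h => h s hs hI
  · rw [if_neg hI, mul_one]
    by_cases hall : ∀ k ∈ S, ¬ IkEvent (annulusFinset ℓ u k) (ℓ k) (ℓ (k + 1)) u (pq.1.1 + pq.1.2) (pq.2.1 + pq.2.2)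
    · rw [if_pos hall, if_pos fun k hk => hall k (Finset.mem_of_mem_erase hk)]
    · rw [if_neg hall, if_neg]
      intro h
      refine hall fun k hk => ?_
      by_cases hks : k = s
      · subst hks; exact hI
      · exact h k (Finset.mem_erase.2 ⟨hks, hk⟩)

omit [PseudoMetricSpace V] in
/-- **Locality of the restriction**: currents agreeing on the edges inside `W` have the same
restriction to `W`. [folklore] -/
theorem restrictTo_congr {W : Finset V} {m m' : Current G}
    (h : ∀ e : G.edgeFinset, (∀ v ∈ (e : Sym2 V), v ∈ W) → m e = m' e) :
    restrictTo W m = restrictTo W m' := by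
  funext e
  unfold restrictTo
  split_ifs with he
  · exact h e he
  · rfl

/-- `I_k` only depends on the restrictions of the two currents to the annulus (the measurability
behind "the event `I_s` is expressed in terms of just the restriction of the currents `n₁,…,n₄` to
`Ann(ℓ_s, ℓ_{s+1})`", p. 14). [cite: AizenmanDuminilCopinAnnals2021, arXiv:1912.07973 §4.2, proof of Prop. 4.3 (p. 14)] -/
theorem ikEvent_congr {W : Finset V} {a b : ℕ} {u : V} {m₁ m₁' m₂ m₂' : Current G}
    (h₁ : restrictTo W m₁ = restrictTo W m₁') (h₂ : restrictTo W m₂ = restrictTo W m₂') :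
    IkEvent W a b u m₁ m₂ ↔ IkEvent W a b u m₁' m₂' := by
  unfold IkEvent UniqueCrossing CrossAt
  rw [h₁, h₂]

omit [PseudoMetricSpace V] in
/-- Agreement of the four currents on the edges inside the `k`-th annulus forces agreement of the two
restricted sums. [folklore] -/
theorem restrictTo_add_congr_of_fourAgree {A : Finset G.edgeFinset} {W : Finset V}
    (hW : ∀ e : G.edgeFinset, (∀ v ∈ (e : Sym2 V), v ∈ W) → e ∈ A) {pq pq' : FourCfg G}
    (hag : FourAgree A pq pq') :
    restrictTo W (pq.1.1 + pq.1.2) = restrictTo W (pq'.1.1 + pq'.1.2) ∧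
      restrictTo W (pq.2.1 + pq.2.2) = restrictTo W (pq'.2.1 + pq'.2.2) := by
  constructor
  · refine restrictTo_congr fun e he => ?_
    obtain ⟨h1, h2, -, -⟩ := hag e (hW e he)
    simp only [Pi.add_apply, h1, h2]
  · refine restrictTo_congr fun e he => ?_
    obtain ⟨-, -, h3, h4⟩ := hag e (hW e he)
    simp only [Pi.add_apply, h3, h4]

/-- The edges inside the `k`-th annulus lie within `Λ_r(u)` as soon as `ℓ_{k+1} ≤ r`. [folklore] -/
theorem mem_edgesWithin_of_annulus {ℓ : ℕ → ℕ} {u : V} {k r : ℕ} (hr : ℓ (k + 1) ≤ r) (e : G.edgeFinset)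
    (he : ∀ v ∈ (e : Sym2 V), v ∈ annulusFinset ℓ u k) : e ∈ edgesWithin u r := by
  rw [mem_edgesWithin]
  intro v hv
  have h := (mem_annulusFinset_iff.1 (he v hv)).2
  exact h.trans (by exact_mod_cast hr)

/-- The edges inside the `k`-th annulus lie outside `Λ_r(u)` as soon as `r ≤ ℓ_k`. [folklore] -/
theorem mem_edgesBeyond_of_annulus {ℓ : ℕ → ℕ} {u : V} {k r : ℕ} (hr : r ≤ ℓ k) (e : G.edgeFinset)
    (he : ∀ v ∈ (e : Sym2 V), v ∈ annulusFinset ℓ u k) : e ∈ edgesBeyond u r := by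
  rw [mem_edgesBeyond]
  intro v hv
  have h := (mem_annulusFinset_iff.1 (he v hv)).1
  exact le_trans (by exact_mod_cast hr) h

/-- **`I_k` is local inside `Λ_r(u)` for `ℓ_{k+1} ≤ r`.** [cite: AizenmanDuminilCopinAnnals2021, arXiv:1912.07973 §4.2, proof of Prop. 4.3 (locality of I_s, p. 14)] -/
theorem fourLocal_ikInd_within {ℓ : ℕ → ℕ} (u : V) {k r : ℕ} (hr : ℓ (k + 1) ≤ r) :
    FourLocal (edgesWithin u r) (ikInd (G := G) ℓ u k) := by
  intro pq pq' hag
  obtain ⟨h1, h2⟩ := restrictTo_add_congr_of_fourAgree (mem_edgesWithin_of_annulus hr) hag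
  unfold ikInd
  rw [ikEvent_congr h1 h2]

/-- **`I_kᶜ` is local outside `Λ_r(u)` for `r ≤ ℓ_k`.** [cite: AizenmanDuminilCopinAnnals2021, arXiv:1912.07973 §4.2, proof of Prop. 4.3 (locality of I_s, p. 14)] -/
theorem fourLocal_ikcInd_beyond {ℓ : ℕ → ℕ} (u : V) {k r : ℕ} (hr : r ≤ ℓ k) :
    FourLocal (edgesBeyond u r) (ikcInd (G := G) ℓ u k) := by
  intro pq pq' hag
  obtain ⟨h1, h2⟩ := restrictTo_add_congr_of_fourAgree (mem_edgesBeyond_of_annulus hr) hag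
  unfold ikcInd
  rw [ikEvent_congr h1 h2]

/-- **`A_S` is local inside `Λ_r(u)`** when `ℓ_{k+1} ≤ r` for all `k ∈ S` ("the event `A_S` depends on
the currents inside `Λ_{ℓ_{K-2}}`", p. 22). [cite: AizenmanDuminilCopinAnnals2021, arXiv:1912.07973 §6.1, proof of Prop. 6.1 (p. 22)] -/
theorem fourLocal_asInd {ℓ : ℕ → ℕ} (u : V) {S : Finset ℕ} {r : ℕ} (hr : ∀ k ∈ S, ℓ (k + 1) ≤ r) :
    FourLocal (edgesWithin u r) (asInd (G := G) ℓ u S) := by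
  intro pq pq' hag
  have hiff : ∀ k ∈ S, (IkEvent (annulusFinset ℓ u k) (ℓ k) (ℓ (k + 1)) u (pq.1.1 + pq.1.2) (pq.2.1 + pq.2.2) ↔
      IkEvent (annulusFinset ℓ u k) (ℓ k) (ℓ (k + 1)) u (pq'.1.1 + pq'.1.2) (pq'.2.1 + pq'.2.2)) := by
    intro k hk
    obtain ⟨h1, h2⟩ := restrictTo_add_congr_of_fourAgree (mem_edgesWithin_of_annulus (hr k hk)) hag
    exact ikEvent_congr h1 h2
  have key : (∀ k ∈ S, ¬ IkEvent (annulusFinset ℓ u k) (ℓ k) (ℓ (k + 1)) u (pq.1.1 + pq.1.2) (pq.2.1 + pq.2.2)) ↔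
      (∀ k ∈ S, ¬ IkEvent (annulusFinset ℓ u k) (ℓ k) (ℓ (k + 1)) u (pq'.1.1 + pq'.1.2) (pq'.2.1 + pq'.2.2)) :=
    forall₂_congr fun k hk => by rw [hiff k hk]
  unfold asInd
  by_cases hall : ∀ k ∈ S, ¬ IkEvent (annulusFinset ℓ u k) (ℓ k) (ℓ (k + 1)) u (pq.1.1 + pq.1.2) (pq.2.1 + pq.2.2)
  · rw [if_pos hall, if_pos (key.1 hall)]
  · rw [if_neg hall, if_neg fun h => hall (key.2 h)]

variable {u : V}

/-- **`B_S ⊆ A_S`, indicator form** (Aizenman–Duminil-Copin 2021, p. 14: "Let `B_S ⊂ A_S` be the event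
that the clusters of `0` in `n₁+n₃` and `n₂+n₄` do not intersect in any of the annuli
`Ann(ℓ_s, ℓ_{s+1})` for `s ∈ S`"): on a graph whose edges change the integer distance to `u` by at most
one, if the clusters of `u` reach `x` resp. `z` at distance `≥ ℓ_{k+1}` for all `k ∈ S`, then
`𝟙[C_{n₁+n₃}(u) ∩ C_{n₂+n₄}(u) ∩ annuli(S) = ∅] ≤ 𝟙[A_S]`.
[cite: AizenmanDuminilCopinAnnals2021, arXiv:1912.07973 §4.2, proof of Prop. 4.3 (B_S ⊂ A_S, p. 14–15)] -/
theorem fourAvoidInd_le_asInd (hstep : ∀ v w, G.Adj v w → dist u w ≤ dist u v + 1)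
    (hint : ∀ v, ∃ n : ℕ, dist u v = n) {ℓ : ℕ → ℕ} {S : Finset ℕ} (hℓ : ∀ k ∈ S, ℓ k ≤ ℓ (k + 1))
    {x z : V} (hx : ∀ k ∈ S, (ℓ (k + 1) : ℝ) ≤ dist u x) (hz : ∀ k ∈ S, (ℓ (k + 1) : ℝ) ≤ dist u z)
    (pq : FourCfg G) (hxc : x ∈ (pq.1.1 + pq.1.2).cluster u) (hzc : z ∈ (pq.2.1 + pq.2.2).cluster u) :
    fourAvoidInd u (annuliFinset ℓ u S) pq ≤ asInd ℓ u S pq := by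
  unfold asInd
  split_ifs with hall
  · unfold fourAvoidInd
    split_ifs
    · exact le_rfl
    · exact zero_le_one
  · push Not at hall
    obtain ⟨k, hk, hI⟩ := hall
    have hocc := annulusOccupied_of_ikEvent hstep hint (hℓ k hk) hI hxc (hx k hk) hzc (hz k hk)
    have hnd : ¬ Disjoint ((pq.1.1 + pq.1.2).cluster u ∩ (pq.2.1 + pq.2.2).cluster u) (annuliFinset ℓ u S) :=
      fun hd => (disjoint_annuliFinset_iff.1 hd) k hk hocc
    unfold fourAvoidInd
    rw [if_neg hnd]

/-- **`B_S ⊆ A_S`, mass form**: `M^{∅,xu;∅,zu}[𝒯_u ∩ annuli(S) = ∅] ≤ fourMass K u x z 𝟙[A_S]`, i.e.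
`P^{ux,uz,∅,∅}[B_S] ≤ P^{ux,uz,∅,∅}[A_S]`, when `x`, `z` are at distance `≥ ℓ_{k+1}` from `u` for every
`k ∈ S` (the sources `x ∈ C_{n₁+n₃}(u)`, `z ∈ C_{n₂+n₄}(u)` force the crossings).
[cite: AizenmanDuminilCopinAnnals2021, arXiv:1912.07973 §4.2, proof of Prop. 4.3 (P[B_S] ≤ P[A_S], p. 15)] -/
theorem fourAvoidMass_le_fourMass_asInd (hstep : ∀ v w, G.Adj v w → dist u w ≤ dist u v + 1)
    (hint : ∀ v, ∃ n : ℕ, dist u v = n) (K : G.edgeFinset → ℝ) {ℓ : ℕ → ℕ} {S : Finset ℕ}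
    (hℓ : ∀ k ∈ S, ℓ k ≤ ℓ (k + 1)) {x z : V} (hx : ∀ k ∈ S, (ℓ (k + 1) : ℝ) ≤ dist u x)
    (hz : ∀ k ∈ S, (ℓ (k + 1) : ℝ) ≤ dist u z) :
    fourAvoidMass K ∅ ({x} ∆ {u}) ∅ ({z} ∆ {u}) u (annuliFinset ℓ u S) ≤ fourMass K u x z (asInd ℓ u S) := by
  rw [fourAvoidMass_eq_fourMass]
  refine fourMass_mono_of_support K u x z fun pq hw => ?_
  obtain ⟨hxc, hzc⟩ := mem_cluster_of_fourWeight_ne_zero hw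
  exact fourAvoidInd_le_asInd hstep hint hℓ hx hz pq hxc hzc

/-! ### Part 3. The induction `P[A_S] ≤ (1 - c₀)^{|S|}` from the intersection and mixing properties -/

/-- `fourMass 𝟙[I_k] + fourMass 𝟙[I_kᶜ] = fourNrm`. [folklore] -/
theorem fourMass_ikInd_add_ikcInd (K : G.edgeFinset → ℝ) (ℓ : ℕ → ℕ) (u a b : V) (k : ℕ) :
    fourMass K u a b (ikInd ℓ u k) + fourMass K u a b (ikcInd ℓ u k) = fourNrm K u a b := by
  have h : ikInd (G := G) ℓ u k + ikcInd ℓ u k = fun _ => 1 := funext fun pq => ikInd_add_ikcInd ℓ u k pq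
  rw [← fourMass_add, h, fourMass_one]

/-- `fourMass 𝟙[A_∅] = fourNrm`. [folklore] -/
theorem fourMass_asInd_empty (K : G.edgeFinset → ℝ) (ℓ : ℕ → ℕ) (u a b : V) :
    fourMass K u a b (asInd ℓ u ∅) = fourNrm K u a b := by
  have h : asInd (G := G) ℓ u ∅ = fun _ => 1 := funext fun pq => asInd_empty ℓ u pq
  rw [h, fourMass_one]

/-- **The induction of Aizenman–Duminil-Copin 2021, proof of Prop. 4.3 / Prop. 6.1, from the two
probabilistic inputs.** Setting: couplings `K ≥ 0` on a finite graph with a pseudo-metric, a centre `u`,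
a far vertex `y` (the common far source of `n₃` and `n₄` in the layout `P^{uy,uy,∅,∅}`), a monotone scale
sequence `ℓ`, and a finite set `E` of usable indices any two of which differ by at least `2` (printed:
"subsets `S` of even integers in `{1,…,K-3}`"). HYPOTHESES, for every `s ∈ E`: the **intersection
property** (Lemma 4.4 / 6.2) `P^{uy,uy,∅,∅}[I_s] ≥ 2c₀`, un-normalised (`hint`); the **mixing
property** (Prop. 4.6 / Thm 6.4 "used with `n = ℓ_{s-1}` and `N = ℓ_s`"), in the one-sided form that is
used: for functionals `Φ, Ψ ≤ 1` of the four currents, `Φ` local on the edges within `Λ_{ℓ_{s-1}}(u)` and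
`Ψ` local on the edges outside `Λ_{ℓ_s}(u)`, `E[ΦΨ] ≤ E[Φ]E[Ψ] + ε_s`, un-normalised (`hmix`); and the
size of the error, `ε_s ≤ c₀(1-c₀)^{#{k ∈ E : k < s}}` (`hε`; printed: "an elementary bound on `ℓ_{s-1}`
gives the existence of `c₀ > 0` small enough that `P[A_S] ≤ (1-2c₀)P[A_{S∖{s}}] + c₀(1-c₀)^{|S|-1}`").
CONCLUSION: "`P^{0y,0y,∅,∅}[A_S] ≤ (1-c₀)^{|S|}`" for every `S ⊆ E`, un-normalised:
`fourMass 𝟙[A_S] ≤ (1-c₀)^{|S|} · fourNrm`. Proof as printed: `A_S = A_{S∖{s}} ∩ I_sᶜ` with `s = max S`,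
`A_{S∖{s}}` is local inside `Λ_{ℓ_{s-1}}(u)` (gaps `≥ 2`) and `I_sᶜ` outside `Λ_{ℓ_s}(u)`, mixing,
`P[I_sᶜ] ≤ 1 - 2c₀`, and the tree's induction lemma `le_pow_card_of_erase_max_step`.
[cite: AizenmanDuminilCopinAnnals2021, arXiv:1912.07973 §4.2, proof of Prop. 4.3 (the displays for P[A_S], p. 14); §6.1, proof of Prop. 6.1 ("we apply the mixing property repeatedly … and the intersection property", p. 22)] -/
theorem fourMass_asInd_le_pow (hK : ∀ e, 0 ≤ K e) {ℓ : ℕ → ℕ} (hℓ : Monotone ℓ) (u y : V)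
    {E : Finset ℕ} (hgap : ∀ k ∈ E, ∀ k' ∈ E, k < k' → k + 2 ≤ k') {c₀ : ℝ} (hc₀ : 0 ≤ c₀)
    (hc₀' : c₀ ≤ 1 / 2) (ε : ℕ → ℝ≥0∞)
    (hint : ∀ s ∈ E, ENNReal.ofReal (2 * c₀) * fourNrm K u y y ≤ fourMass K u y y (ikInd ℓ u s))
    (hmix : ∀ s ∈ E, ∀ Φ Ψ : FourCfg G → ℝ≥0∞, (∀ pq, Φ pq ≤ 1) → (∀ pq, Ψ pq ≤ 1) →
      FourLocal (edgesWithin u (ℓ (s - 1))) Φ → FourLocal (edgesBeyond u (ℓ s)) Ψ →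
      fourMass K u y y (Φ * Ψ) * fourNrm K u y y ≤
        fourMass K u y y Φ * fourMass K u y y Ψ + ε s * fourNrm K u y y ^ 2)
    (hε : ∀ s ∈ E, ε s ≤ ENNReal.ofReal (c₀ * (1 - c₀) ^ #(E.filter (· < s)))) :
    ∀ S ⊆ E, fourMass K u y y (asInd ℓ u S) ≤ ENNReal.ofReal ((1 - c₀) ^ #S) * fourNrm K u y y := by
  intro S hSE
  set N : ℝ≥0∞ := fourNrm K u y y with hN
  have hNtop : N ≠ ∞ := fourNrm_ne_top hK u y y
  have hM1 : ∀ {Φ : FourCfg G → ℝ≥0∞}, (∀ pq, Φ pq ≤ 1) → fourMass K u y y Φ ≤ N := fun h =>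
    fourMass_le_fourNrm K u y y h
  have hMtop : ∀ {Φ : FourCfg G → ℝ≥0∞}, (∀ pq, Φ pq ≤ 1) → fourMass K u y y Φ ≠ ∞ := fun h =>
    fourMass_ne_top hK u y y h
  by_cases hN0 : N = 0
  · calc fourMass K u y y (asInd ℓ u S) ≤ N := hM1 (asInd_le_one ℓ u S)
      _ = 0 := hN0
      _ ≤ _ := zero_le
  have hNpos : 0 < N.toReal := ENNReal.toReal_pos hN0 hNtop
  have h1c : 0 ≤ 1 - c₀ := by linarith
  have h1c' : 1 - c₀ ≤ 1 := by linarith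
  -- the normalised probabilities `P(S) = fourMass 𝟙[A_S] / N`
  set P : Finset ℕ → ℝ := fun S => (fourMass K u y y (asInd ℓ u S)).toReal / N.toReal with hP
  have key : ∀ S ⊆ E, P S ≤ (1 - c₀) ^ #S := by
    refine le_pow_card_of_erase_max_step P hc₀' ?_ ?_
    · -- `P(∅) = 1`
      simp only [hP]
      rw [fourMass_asInd_empty, div_self hNpos.ne']
    · intro S hSE hS
      -- the step `P(S) ≤ (1 - 2c₀) P(S ∖ {s}) + ε_s`
      set s : ℕ := S.max' hS with hs
      have hsS : s ∈ S := Finset.max'_mem S hS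
      have hsE : s ∈ E := hSE hsS
      set S' : Finset ℕ := S.erase s with hS'
      -- the elements of `S'` are usable indices `< s`, hence `≤ s - 2`
      have hS'lt : ∀ k ∈ S', k < s := by
        intro k hk
        rw [hS', Finset.mem_erase] at hk
        exact lt_of_le_of_ne (Finset.le_max' S k hk.2) hk.1
      have hS'sub : S' ⊆ E.filter (· < s) := by
        intro k hk
        rw [Finset.mem_filter]
        exact ⟨hSE (Finset.mem_of_mem_erase hk), hS'lt k hk⟩
      -- locality of the two functionals
      set Φ : FourCfg G → ℝ≥0∞ := asInd ℓ u S' with hΦ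
      set Ψ : FourCfg G → ℝ≥0∞ := ikcInd ℓ u s with hΨ
      have hΦ1 : ∀ pq, Φ pq ≤ 1 := asInd_le_one ℓ u S'
      have hΨ1 : ∀ pq, Ψ pq ≤ 1 := ikcInd_le_one ℓ u s
      have hΦloc : FourLocal (edgesWithin u (ℓ (s - 1))) Φ := by
        refine fourLocal_asInd u fun k hk => hℓ ?_
        have hk2 : k + 2 ≤ s := hgap k (hSE (Finset.mem_of_mem_erase hk)) s hsE (hS'lt k hk)
        omega
      have hΨloc : FourLocal (edgesBeyond u (ℓ s)) Ψ := fourLocal_ikcInd_beyond u le_rfl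
      -- `𝟙[A_S] = Φ Ψ`
      have hprod : fourMass K u y y (asInd ℓ u S) = fourMass K u y y (Φ * Ψ) := by
        unfold fourMass
        refine tsum_congr fun pq => ?_
        rw [Pi.mul_apply, asInd_eq_erase_mul hsS pq]
      -- the mixing inequality, in `ℝ`
      have hm := hmix s hsE Φ Ψ hΦ1 hΨ1 hΦloc hΨloc
      have hΦΨ1 : ∀ pq, (Φ * Ψ) pq ≤ 1 := fun pq => by
        rw [Pi.mul_apply]
        calc Φ pq * Ψ pq ≤ 1 * 1 := mul_le_mul' (hΦ1 pq) (hΨ1 pq)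
          _ = 1 := one_mul 1
      have hεtop : ε s ≠ ∞ := ne_top_of_le_ne_top ENNReal.ofReal_ne_top (hε s hsE)
      have hεreal : (ε s).toReal ≤ c₀ * (1 - c₀) ^ #(E.filter (· < s)) := by
        have := ENNReal.toReal_mono ENNReal.ofReal_ne_top (hε s hsE)
        rwa [ENNReal.toReal_ofReal (by positivity)] at this
      have hm' : (fourMass K u y y (Φ * Ψ)).toReal * N.toReal ≤
          (fourMass K u y y Φ).toReal * (fourMass K u y y Ψ).toReal + (ε s).toReal * N.toReal ^ 2 := by
        have hR : fourMass K u y y Φ * fourMass K u y y Ψ + ε s * N ^ 2 ≠ ∞ :=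
          ENNReal.add_ne_top.2 ⟨ENNReal.mul_ne_top (hMtop hΦ1) (hMtop hΨ1),
            ENNReal.mul_ne_top hεtop (ENNReal.pow_ne_top hNtop)⟩
        have := ENNReal.toReal_mono hR hm
        rwa [ENNReal.toReal_mul, ENNReal.toReal_add (ENNReal.mul_ne_top (hMtop hΦ1) (hMtop hΨ1))
          (ENNReal.mul_ne_top hεtop (ENNReal.pow_ne_top hNtop)), ENNReal.toReal_mul, ENNReal.toReal_mul,
          ENNReal.toReal_pow] at this
      -- `P[I_sᶜ] ≤ 1 - 2c₀`
      have hΨle : (fourMass K u y y Ψ).toReal ≤ (1 - 2 * c₀) * N.toReal := by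
        have hsum := fourMass_ikInd_add_ikcInd K ℓ u y y s
        have hsum' : (fourMass K u y y (ikInd ℓ u s)).toReal + (fourMass K u y y Ψ).toReal = N.toReal := by
          rw [← ENNReal.toReal_add (hMtop (ikInd_le_one ℓ u s)) (hMtop hΨ1), hsum]
        have hi := ENNReal.toReal_mono (hMtop (ikInd_le_one ℓ u s)) (hint s hsE)
        rw [ENNReal.toReal_mul, ENNReal.toReal_ofReal (by positivity)] at hi
        linarith
      -- assemble: `P(S) ≤ (1 - 2c₀) P(S') + ε_s`
      have h12 : 0 ≤ 1 - 2 * c₀ := by linarith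
      have hΦ0 : 0 ≤ (fourMass K u y y Φ).toReal := ENNReal.toReal_nonneg
      have hfin : (fourMass K u y y (Φ * Ψ)).toReal ≤
          (1 - 2 * c₀) * (fourMass K u y y Φ).toReal + (ε s).toReal * N.toReal := by
        have h2 : (fourMass K u y y (Φ * Ψ)).toReal * N.toReal ≤
            ((1 - 2 * c₀) * (fourMass K u y y Φ).toReal + (ε s).toReal * N.toReal) * N.toReal :=
          calc (fourMass K u y y (Φ * Ψ)).toReal * N.toReal
              ≤ (fourMass K u y y Φ).toReal * (fourMass K u y y Ψ).toReal + (ε s).toReal * N.toReal ^ 2 := hm'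
            _ ≤ (fourMass K u y y Φ).toReal * ((1 - 2 * c₀) * N.toReal) + (ε s).toReal * N.toReal ^ 2 := by
                gcongr
            _ = ((1 - 2 * c₀) * (fourMass K u y y Φ).toReal + (ε s).toReal * N.toReal) * N.toReal := by ring
        exact le_of_mul_le_mul_right h2 hNpos
      have hN0' : N.toReal ≠ 0 := hNpos.ne'
      have hPS : P S ≤ (1 - 2 * c₀) * P S' + (ε s).toReal := by
        simp only [hP]
        rw [hprod]
        calc (fourMass K u y y (Φ * Ψ)).toReal / N.toReal
            ≤ ((1 - 2 * c₀) * (fourMass K u y y Φ).toReal + (ε s).toReal * N.toReal) / N.toReal :=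
              div_le_div_of_nonneg_right hfin hNpos.le
          _ = (1 - 2 * c₀) * ((fourMass K u y y Φ).toReal / N.toReal) + (ε s).toReal := by
              field_simp
      -- the error term: `ε_s ≤ c₀ (1 - c₀)^{#S - 1}`
      have hcard : #S - 1 ≤ #(E.filter (· < s)) := by
        have h1 := Finset.card_le_card hS'sub
        rw [hS', Finset.card_erase_of_mem hsS] at h1
        exact h1
      have hεS : (ε s).toReal ≤ c₀ * (1 - c₀) ^ (#S - 1) :=
        hεreal.trans (mul_le_mul_of_nonneg_left (pow_le_pow_of_le_one h1c h1c' hcard) hc₀)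
      linarith
  -- back to `ℝ≥0∞`
  have h := key S hSE
  simp only [hP] at h
  rw [div_le_iff₀ hNpos] at h
  have hMS := hMtop (asInd_le_one ℓ u S)
  calc fourMass K u y y (asInd ℓ u S) = ENNReal.ofReal ((fourMass K u y y (asInd ℓ u S)).toReal) :=
        (ENNReal.ofReal_toReal hMS).symm
    _ ≤ ENNReal.ofReal ((1 - c₀) ^ #S * N.toReal) := ENNReal.ofReal_le_ofReal h
    _ = ENNReal.ofReal ((1 - c₀) ^ #S) * N := by
        rw [ENNReal.ofReal_mul (pow_nonneg h1c _), ENNReal.ofReal_toReal hNtop]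

/-! ### Part 4. The union bound and the removal of two sources at a general threshold -/

/-- **Within-pair symmetry of the clustering mass** (general threshold): exchanging the two currents of
each pair, `clusteringMassLT x y z t u = clusteringMassLT y x t z u` ("Without loss of generality we take
that to be `x`, and make a similar assumption about `z`", p. 14). [cite: AizenmanDuminilCopinAnnals2021, arXiv:1912.07973 §4.2, proof of Prop. 4.3 (first paragraph, p. 14)] -/
theorem clusteringMassLT_swap (K : G.edgeFinset → ℝ) (ℓ : ℕ → ℕ) (Ks θ : ℕ) (x y z t u : V) :
    clusteringMassLT K ℓ Ks θ x y z t u = clusteringMassLT K ℓ Ks θ y x t z u := by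
  unfold clusteringMassLT
  rw [← ((Equiv.prodComm (Current G) (Current G)).prodCongr
    (Equiv.prodComm (Current G) (Current G))).tsum_eq]
  refine tsum_congr fun pq => ?_
  simp only [Equiv.prodCongr_apply, Equiv.prodComm_apply, Prod.map_fst, Prod.map_snd, Prod.fst_swap,
    Prod.snd_swap, epairWeight_swap, add_comm pq.1.2 pq.1.1, add_comm pq.2.2 pq.2.1]


/-- Symmetry within the first pair only: `clusteringMassLT x y z t u = clusteringMassLT y x z t u`. [cite: AizenmanDuminilCopinAnnals2021, arXiv:1912.07973 §4.2, proof of Prop. 4.3 (first paragraph, p. 14)] -/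
theorem clusteringMassLT_swap_left (K : G.edgeFinset → ℝ) (ℓ : ℕ → ℕ) (Ks θ : ℕ) (x y z t u : V) :
    clusteringMassLT K ℓ Ks θ x y z t u = clusteringMassLT K ℓ Ks θ y x z t u := by
  unfold clusteringMassLT
  rw [← ((Equiv.prodComm (Current G) (Current G)).prodCongr
    (Equiv.refl (Current G × Current G))).tsum_eq]
  refine tsum_congr fun pq => ?_
  simp only [Equiv.prodCongr_apply, Equiv.prodComm_apply, Prod.map_fst, Prod.map_snd, Prod.fst_swap,
    Prod.snd_swap, epairWeight_swap, add_comm pq.1.2 pq.1.1, Equiv.refl_apply]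

/-- Symmetry within the second pair only: `clusteringMassLT x y z t u = clusteringMassLT x y t z u`. [cite: AizenmanDuminilCopinAnnals2021, arXiv:1912.07973 §4.2, proof of Prop. 4.3 (first paragraph, p. 14)] -/
theorem clusteringMassLT_swap_right (K : G.edgeFinset → ℝ) (ℓ : ℕ → ℕ) (Ks θ : ℕ) (x y z t u : V) :
    clusteringMassLT K ℓ Ks θ x y z t u = clusteringMassLT K ℓ Ks θ x y t z u := by
  rw [clusteringMassLT_swap K ℓ Ks θ x y z t u, clusteringMassLT_swap_left K ℓ Ks θ y x t z u]

/-- **Small thresholds are vacuous**: the centre `u` always lies in `𝒯_u = C_{n₁+n₃}(u) ∩ C_{n₂+n₄}(u)` and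
in its own `0`-th annulus when `ℓ₀ = 0` (as for the scales of ADC §6.1, "`ℓ₀ = 0`"), so `𝐌_u ≥ 1` and
`clusteringMassLT(θ) = 0` for `θ ≤ 1`. [cite: AizenmanDuminilCopinAnnals2021, arXiv:1912.07973 §6.1, definition of ℓ_k ("ℓ₀ = 0")] -/
theorem clusteringMassLT_eq_zero_of_le_one (K : G.edgeFinset → ℝ) {ℓ : ℕ → ℕ} (h0 : ℓ 0 = 0) (Ks : ℕ)
    {θ : ℕ} (hθ : θ ≤ 1) (x y z t u : V) : clusteringMassLT K ℓ Ks θ x y z t u = 0 := by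
  unfold clusteringMassLT
  refine ENNReal.tsum_eq_zero.2 fun pq => ?_
  have hocc : AnnulusOccupied ℓ ((pq.1.1 + pq.1.2).cluster u ∩ (pq.2.1 + pq.2.2).cluster u) u 0 :=
    ⟨u, Finset.mem_inter.2 ⟨mem_cluster_self _ u, mem_cluster_self _ u⟩, by simp [h0], by simp⟩
  have h1 : 1 ≤ annulusCount ℓ Ks ((pq.1.1 + pq.1.2).cluster u ∩ (pq.2.1 + pq.2.2).cluster u) u := by
    classical
    unfold annulusCount
    refine Finset.card_pos.2 ⟨0, ?_⟩
    rw [Finset.mem_filter, Finset.mem_range]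
    exact ⟨Nat.succ_pos Ks, hocc⟩
  rw [if_neg (by omega), mul_zero]

/-- **The union bound at a general threshold `θ`** (Aizenman–Duminil-Copin 2021, proof of Prop. 4.3:
"`P[𝐌_0 < δK] ≤ ∑_{S ∈ 𝒮_K : |S| ≥ (½-δ)K} P[B_S]`"), un-normalised, for any finite `E ⊆ {0,…,K_s}`:
`clusteringMassLT(θ) ≤ ∑_{S ⊆ E, |S| = |E|+1-θ} M^{uy,ux;ut,uz}[𝒯_u ∩ annuli_u(S) = ∅]` (the tree's
`clusteringMass_le_sum_fourAvoidMass` is the case `θ = 7r`). [cite: AizenmanDuminilCopinAnnals2021, arXiv:1912.07973 §4.2, proof of Prop. 4.3 (p. 15); §6.1, Prop. 6.1] -/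
theorem clusteringMassLT_le_sum_fourAvoidMass (K : G.edgeFinset → ℝ) (ℓ : ℕ → ℕ) {Ks : ℕ} (θ : ℕ)
    {E : Finset ℕ} (hE : E ⊆ range (Ks + 1)) (x y z t u : V) :
    clusteringMassLT K ℓ Ks θ x y z t u ≤
      ∑ S ∈ E.powersetCard (#E + 1 - θ),
        fourAvoidMass K ({y} ∆ {u}) ({x} ∆ {u}) ({t} ∆ {u}) ({z} ∆ {u}) u (annuliFinset ℓ u S) := by
  unfold clusteringMassLT fourAvoidMass
  rw [← Summable.tsum_finsetSum (fun _ _ => ENNReal.summable)]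
  refine ENNReal.tsum_le_tsum fun pq => ?_
  rw [← Finset.mul_sum]
  refine mul_le_mul' le_rfl ?_
  exact indicator_annulusCount_lt_le_sum _ u θ hE

/-- **Removing the sources `y`, `t` at a general threshold** ("Thanks to Corollary A.2, the probability
of `B_S` increases when removing sources"): with `Z = ecurrentSum K`,
`clusteringMassLT(θ) · Z[∅]² ≤ Z[{u,y}] Z[{u,t}] · ∑_{S ⊆ E, |S| = |E|+1-θ} M^{∅,xu;∅,zu}[𝒯_u ∩ annuli_u(S) = ∅]`.
[cite: AizenmanDuminilCopinAnnals2021, arXiv:1912.07973 §4.2, proof of Prop. 4.3 (p. 14–15) with Appendix A, Cor. A.2] -/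
theorem clusteringMassLT_mul_sq_le_sum (hK : ∀ e, 0 ≤ K e) (ℓ : ℕ → ℕ) {Ks : ℕ} (θ : ℕ)
    {E : Finset ℕ} (hE : E ⊆ range (Ks + 1)) (x y z t u : V) :
    clusteringMassLT K ℓ Ks θ x y z t u * ecurrentSum K ∅ ^ 2 ≤
      ecurrentSum K ({u} ∆ {y}) * ecurrentSum K ({u} ∆ {t}) *
        ∑ S ∈ E.powersetCard (#E + 1 - θ),
          fourAvoidMass K ∅ ({x} ∆ {u}) ∅ ({z} ∆ {u}) u (annuliFinset ℓ u S) := by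
  calc clusteringMassLT K ℓ Ks θ x y z t u * ecurrentSum K ∅ ^ 2
      ≤ (∑ S ∈ E.powersetCard (#E + 1 - θ),
          fourAvoidMass K ({y} ∆ {u}) ({x} ∆ {u}) ({t} ∆ {u}) ({z} ∆ {u}) u (annuliFinset ℓ u S)) *
          ecurrentSum K ∅ ^ 2 :=
        mul_le_mul' (clusteringMassLT_le_sum_fourAvoidMass K ℓ θ hE x y z t u) le_rfl
    _ = ∑ S ∈ E.powersetCard (#E + 1 - θ),
          fourAvoidMass K ({u} ∆ {y}) ({x} ∆ {u}) ({u} ∆ {t}) ({z} ∆ {u}) u (annuliFinset ℓ u S) *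
            ecurrentSum K ∅ ^ 2 := by
        rw [Finset.sum_mul]
        simp only [symmDiff_comm ({y} : Finset V) {u}, symmDiff_comm ({t} : Finset V) {u}]
    _ ≤ ∑ S ∈ E.powersetCard (#E + 1 - θ), ecurrentSum K ({u} ∆ {y}) * ecurrentSum K ({u} ∆ {t}) *
          fourAvoidMass K ∅ ({x} ∆ {u}) ∅ ({z} ∆ {u}) u (annuliFinset ℓ u S) :=
        Finset.sum_le_sum fun S _ => fourAvoidMass_mul_sq_le_left hK _ _ u y t _
    _ = _ := by rw [← Finset.mul_sum]

/-! ### Part 5. Proposition 6.1 in finite volume, modulo the intersection, mixing and relocation inputs -/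

/-- **Aizenman–Duminil-Copin 2021, Prop. 4.3 / Prop. 6.1 (intersection-clustering bound) in finite
volume, current-sum form, from its probabilistic inputs.** Setting: couplings `K ≥ 0` on a finite simple
graph whose vertex type carries a pseudo-metric in which nearest-neighbour steps change the (integer)
distance to the centre `u` by at most one; a monotone scale sequence `ℓ`; a set `E ⊆ {0,…,K_s}` of usable
indices with gaps `≥ 2` whose annuli lie inside `Λ_R(u)` (`ℓ_{k+1} ≤ R`); two far sources `x, z`
(distance `≥ R` from `u`; printed: "one of them is at a distance larger than or equal to `ℓ_K` of `u`.
Without loss of generality we take that to be `x`, and … `z`") and a far vertex `y` with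
`Z[∅]Z[{y,u}] ≠ 0` (printed: "`y ∈ Ann(ℓ_{K-1}, ℓ_K)` in a regular scale"). HYPOTHESES: the intersection
property `hint`, the mixing property `hmix` and the error sizes `hε` of `fourMass_asInd_le_pow` (for the
sources `y, y`), and the **relocation of the sources** `hrel` — the second half (6.9) of the mixing
theorem as used on p. 22 ("the mixing property (Theorem 6.4) shows that
`P^{0x,0z,∅,∅}[A_S] ≤ P^{0y,0y,∅,∅}[A_S] + C/√(log ℓ_{K-1})`"): for `Φ ≤ 1` local on the edges within
`Λ_R(u)`, `E^{ux,uz,∅,∅}[Φ] ≤ E^{uy,uy,∅,∅}[Φ] + ε_rel`, un-normalised. CONCLUSION, for every threshold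
`θ` and all second sources `y', t'` of the two pairs:
`clusteringMassLT(θ)(x,y',z,t';u) ≤ binom(|E|, |E|+1-θ) · ((1-c₀)^{|E|+1-θ} + ε_rel) · Z[y'u]Z[xu]Z[t'u]Z[zu]`,
i.e. `P^{ux,uz,uy',ut'}[𝐌_u(𝒯;ℓ,K_s) < θ] ≤ binom(|E|, |E|+1-θ)((1-c₀)^{|E|+1-θ} + ε_rel)` — the printed
chain "`P^{0x,0z,0y,0t}[𝐌_0 < δK] ≤ ∑_S P^{0x,0z,0y,0t}[B_S] ≤ ∑_S P^{0x,0z,∅,∅}[B_S] ≤ ∑_S P^{0x,0z,∅,∅}[A_S]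
≤ binom(K/2, δK)((1-c₀)^{(½-δ)K} [+ relocation error])`" before the final choice of `δ`
(`exists_delta_choose_mul_pow_le_exp_neg`). [cite: AizenmanDuminilCopinAnnals2021, arXiv:1912.07973 §4.2, proof of Prop. 4.3 (pp. 14–15); §6.1, proof of Prop. 6.1 (p. 22)] -/
theorem clusteringMassLT_le_of_inputs (hK : ∀ e, 0 ≤ K e)
    (hstep : ∀ v w, G.Adj v w → dist u w ≤ dist u v + 1) (hdist : ∀ v, ∃ n : ℕ, dist u v = n)
    {ℓ : ℕ → ℕ} (hℓ : Monotone ℓ) {Ks : ℕ} {E : Finset ℕ} (hE : E ⊆ range (Ks + 1))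
    (hgap : ∀ k ∈ E, ∀ k' ∈ E, k < k' → k + 2 ≤ k') {R : ℕ} (hR : ∀ k ∈ E, ℓ (k + 1) ≤ R)
    {x z y : V} (hx : (R : ℝ) ≤ dist u x) (hz : (R : ℝ) ≤ dist u z) (hNy : fourNrm K u y y ≠ 0)
    {c₀ : ℝ} (hc₀ : 0 ≤ c₀) (hc₀' : c₀ ≤ 1 / 2) (ε : ℕ → ℝ≥0∞) (εrel : ℝ≥0∞)
    (hint : ∀ s ∈ E, ENNReal.ofReal (2 * c₀) * fourNrm K u y y ≤ fourMass K u y y (ikInd ℓ u s))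
    (hmix : ∀ s ∈ E, ∀ Φ Ψ : FourCfg G → ℝ≥0∞, (∀ pq, Φ pq ≤ 1) → (∀ pq, Ψ pq ≤ 1) →
      FourLocal (edgesWithin u (ℓ (s - 1))) Φ → FourLocal (edgesBeyond u (ℓ s)) Ψ →
      fourMass K u y y (Φ * Ψ) * fourNrm K u y y ≤
        fourMass K u y y Φ * fourMass K u y y Ψ + ε s * fourNrm K u y y ^ 2)
    (hε : ∀ s ∈ E, ε s ≤ ENNReal.ofReal (c₀ * (1 - c₀) ^ #(E.filter (· < s))))
    (hrel : ∀ Φ : FourCfg G → ℝ≥0∞, (∀ pq, Φ pq ≤ 1) → FourLocal (edgesWithin u R) Φ →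
      fourMass K u x z Φ * fourNrm K u y y ≤
        fourMass K u y y Φ * fourNrm K u x z + εrel * (fourNrm K u x z * fourNrm K u y y))
    (θ : ℕ) (y' t' : V) :
    clusteringMassLT K ℓ Ks θ x y' z t' u ≤
      ((#E).choose (#E + 1 - θ) : ℝ≥0∞) * (ENNReal.ofReal ((1 - c₀) ^ (#E + 1 - θ)) + εrel) *
        (ecurrentSum K ({y'} ∆ {u}) * ecurrentSum K ({x} ∆ {u}) *
          (ecurrentSum K ({t'} ∆ {u}) * ecurrentSum K ({z} ∆ {u}))) := by
  have hZtop : ∀ A, ecurrentSum K A ≠ ∞ := fun A => ecurrentSum_ne_top hK A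
  have hZ0 : ecurrentSum K (∅ : Finset V) ≠ 0 := ecurrentSum_empty_ne_zero K
  have hNytop : fourNrm K u y y ≠ ∞ := fourNrm_ne_top hK u y y
  set q : ℝ≥0∞ := ENNReal.ofReal ((1 - c₀) ^ (#E + 1 - θ)) + εrel with hq
  -- Step 1: the bound for each `S`
  have hS : ∀ S ∈ E.powersetCard (#E + 1 - θ),
      fourAvoidMass K ∅ ({x} ∆ {u}) ∅ ({z} ∆ {u}) u (annuliFinset ℓ u S) ≤ q * fourNrm K u x z := by
    intro S hSmem
    rw [Finset.mem_powersetCard] at hSmem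
    obtain ⟨hSE, hScard⟩ := hSmem
    have hxk : ∀ k ∈ S, (ℓ (k + 1) : ℝ) ≤ dist u x := fun k hk =>
      le_trans (by exact_mod_cast hR k (hSE hk)) hx
    have hzk : ∀ k ∈ S, (ℓ (k + 1) : ℝ) ≤ dist u z := fun k hk =>
      le_trans (by exact_mod_cast hR k (hSE hk)) hz
    -- `B_S ⊆ A_S`
    have h1 := fourAvoidMass_le_fourMass_asInd hstep hdist K (fun k _ => hℓ (Nat.le_succ k)) hxk hzk
      (S := S) (ℓ := ℓ)
    -- relocation of the sources and the induction
    have h2 := hrel (asInd ℓ u S) (asInd_le_one ℓ u S) (fourLocal_asInd u fun k hk => hR k (hSE hk))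
    have h3 := fourMass_asInd_le_pow hK hℓ u y hgap hc₀ hc₀' ε hint hmix hε S hSE
    rw [hScard] at h3
    have h4 : fourMass K u x z (asInd ℓ u S) * fourNrm K u y y ≤ (q * fourNrm K u x z) * fourNrm K u y y :=
      calc fourMass K u x z (asInd ℓ u S) * fourNrm K u y y
          ≤ fourMass K u y y (asInd ℓ u S) * fourNrm K u x z + εrel * (fourNrm K u x z * fourNrm K u y y) := h2
        _ ≤ ENNReal.ofReal ((1 - c₀) ^ (#E + 1 - θ)) * fourNrm K u y y * fourNrm K u x z +
              εrel * (fourNrm K u x z * fourNrm K u y y) := by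
            gcongr
        _ = (q * fourNrm K u x z) * fourNrm K u y y := by rw [hq]; ring
    exact h1.trans ((ENNReal.mul_le_mul_iff_left hNy hNytop).1 h4)
  -- Step 2: sum over `S`, remove the sources `y'`, `t'`
  have hsum := sum_powersetCard_le_choose_mul E (#E + 1 - θ) hS
  have hmain := clusteringMassLT_mul_sq_le_sum hK ℓ θ hE x y' z t' u
  have h5 : clusteringMassLT K ℓ Ks θ x y' z t' u * ecurrentSum K ∅ ^ 2 ≤
      ((#E).choose (#E + 1 - θ) : ℝ≥0∞) * q *
        (ecurrentSum K ({y'} ∆ {u}) * ecurrentSum K ({x} ∆ {u}) *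
          (ecurrentSum K ({t'} ∆ {u}) * ecurrentSum K ({z} ∆ {u}))) * ecurrentSum K ∅ ^ 2 :=
    calc clusteringMassLT K ℓ Ks θ x y' z t' u * ecurrentSum K ∅ ^ 2
        ≤ ecurrentSum K ({u} ∆ {y'}) * ecurrentSum K ({u} ∆ {t'}) *
            ∑ S ∈ E.powersetCard (#E + 1 - θ),
              fourAvoidMass K ∅ ({x} ∆ {u}) ∅ ({z} ∆ {u}) u (annuliFinset ℓ u S) := hmain
      _ ≤ ecurrentSum K ({u} ∆ {y'}) * ecurrentSum K ({u} ∆ {t'}) *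
            (((#E).choose (#E + 1 - θ) : ℝ≥0∞) * (q * fourNrm K u x z)) := mul_le_mul' le_rfl hsum
      _ = _ := by
          rw [symmDiff_comm ({u} : Finset V) {y'}, symmDiff_comm ({u} : Finset V) {t'}]
          unfold fourNrm
          ring
  exact (ENNReal.mul_le_mul_iff_left (pow_ne_zero 2 hZ0) (ENNReal.pow_ne_top (hZtop ∅))).1 h5

end Metric

end Current

end Literature.Probability.LatticeModels
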